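import Literature.Analysis.Complex.BoundedCrossTheoremTwoStrips
import Literature.Analysis.Complex.OsgoodSeparate
import Mathlib.Analysis.Complex.CauchyIntegral
import HarnessLib

/-!
# The bounded cross theorem for three strips

Analysis/Complex support file (everything proved; theorems only, no definitions, no named facts).

* `differentiableOn_prod_of_separately_of_norm_le` — **Osgood's lemma under a bound** (two-block
  form): a function `g : ℂ × P → F` on an open set `U` which is *bounded*, holomorphic in the first
  variable on every slice and holomorphic in the block `P` on every slice is jointly holomorphic on
  `U`.  (The tree's `Literature.Analysis.Complex.SCV.differentiableOn_prod_of_separately` assumes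
  joint continuity instead of the bound; the proof — Cauchy's formula in the first variable and the
  dominated holomorphic parameter integral `differentiableOn_integral_of_dominated` — is the same,
  the bound replacing the compactness argument.)
* `exists_holomorphic_extension_of_separately_three` — **the bounded cross theorem for THREE
  strips**: a function `F` of three real variables each of whose one-variable slices (the two other
  variables real) is the trace of a function holomorphic and bounded by `M` on the strip
  `{|Im| < b}` is the trace of ONE function holomorphic on the tube
  `{|Im z₁| + |Im z₂| + |Im z₃| < b}` and bounded by `M` there.  Proof from the two-strip theorem
  `Literature.Analysis.Complex.exists_holomorphic_extension_diamond_of_separately` (= the named fact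
  `DiamondCross`): extend in `(x, y)` for each real `z` and in `(x, z)` for each real `y`
  (consistent by the identity theorem on the strip); for fixed complex `ξ` the two families give
  separately strip-holomorphic bounded data in `(y, z)` on the strip of width `b - |Im ξ|`, hence a
  joint extension `G(ξ, ·, ·)`; symmetrically `G(·, ·, ζ)` is jointly holomorphic; so `G` is
  separately holomorphic in `ξ` and in the block `(η, ζ)` and bounded by `M`, hence jointly
  holomorphic by the bounded Osgood lemma.

## References

* M. Jarnicki, P. Pflug, *Separately Analytic Functions*, EMS Tracts in Mathematics 16 (2011),
  Ch. 5 (classical cross theorem with estimate; `N`-fold crosses). [JarnickiPflug2011]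
* L. Hörmander, *An Introduction to Complex Analysis in Several Variables* (1973), §2.2
  (Osgood's lemma). [HormanderSCV1973]
-/

noncomputable section

open _root_.Complex Set MeasureTheory Filter Metric
open scoped _root_.Topology

namespace Literature.Analysis.Complex

/-! ### Osgood's lemma under a bound -/

section Osgood

variable {P : Type*} [NormedAddCommGroup P] [NormedSpace ℂ P]
variable {F : Type*} [NormedAddCommGroup F] [NormedSpace ℂ F] [CompleteSpace F]

/-- **Osgood's lemma under a bound, two-block form.** Let `g : ℂ × P → F` be bounded on an open
set `U`, complex differentiable in the first variable on every slice `{t | (t, p) ∈ U}` and complex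
differentiable in the block `P` on every slice `{p | (t, p) ∈ U}`. Then `g` is complex
differentiable on `U` (Cauchy's formula in the first variable writes `g` locally as a parameter
integral with integrand holomorphic in `(t, p)` and bounded, and the dominated holomorphic
parameter integral needs no continuity). [cite: HormanderSCV1973, §2.2 (Osgood's lemma)] -/
theorem differentiableOn_prod_of_separately_of_norm_le {g : ℂ × P → F} {U : Set (ℂ × P)}
    (hU : IsOpen U) {M : ℝ} (hM : ∀ q ∈ U, ‖g q‖ ≤ M)
    (ht : ∀ p : P, DifferentiableOn ℂ (fun t => g (t, p)) {t | (t, p) ∈ U})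
    (hp : ∀ t : ℂ, DifferentiableOn ℂ (fun p => g (t, p)) {p | (t, p) ∈ U}) :
    DifferentiableOn ℂ g U := by
  intro q₀ hq₀
  obtain ⟨ε, hε, hεU⟩ := Metric.isOpen_iff.1 hU q₀ hq₀
  set ρ : ℝ := ε / 2 with hρdef
  have hρ : 0 < ρ := by positivity
  -- the closed bidisc of radius ρ lies in U
  have hsub : closedBall q₀.1 ρ ×ˢ closedBall q₀.2 ρ ⊆ U := by
    intro x hx
    apply hεU
    rw [mem_ball, Prod.dist_eq]
    have h1 : dist x.1 q₀.1 ≤ ρ := mem_closedBall.1 hx.1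
    have h2 : dist x.2 q₀.2 ≤ ρ := mem_closedBall.1 hx.2
    calc max (dist x.1 q₀.1) (dist x.2 q₀.2) ≤ ρ := max_le h1 h2
      _ < ε := by rw [hρdef]; linarith
  -- the neighbourhood on which we prove differentiability
  set V : Set (ℂ × P) := ball q₀.1 (ρ / 2) ×ˢ ball q₀.2 ρ with hV
  have hVo : IsOpen V := isOpen_ball.prod isOpen_ball
  have hq₀V : q₀ ∈ V := ⟨mem_ball_self (by positivity), mem_ball_self hρ⟩
  suffices hdiff : DifferentiableOn ℂ g V from
    (hdiff.differentiableAt (hVo.mem_nhds hq₀V)).differentiableWithinAt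
  have hKU : sphere q₀.1 ρ ×ˢ closedBall q₀.2 ρ ⊆ U :=
    (Set.prod_mono sphere_subset_closedBall Subset.rfl).trans hsub
  have hMg : ∀ x ∈ sphere q₀.1 ρ ×ˢ closedBall q₀.2 ρ, ‖g x‖ ≤ M := fun x hx => hM x (hKU hx)
  -- the slices in the first variable are open and contain the closed disc
  have hslice_open : ∀ p : P, IsOpen {t : ℂ | (t, p) ∈ U} := fun p =>
    hU.preimage (by fun_prop)
  have hslice_sub : ∀ q ∈ V, closedBall q₀.1 ρ ⊆ {t : ℂ | (t, q.2) ∈ U} := fun q hq t ht =>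
    hsub ⟨ht, ball_subset_closedBall hq.2⟩
  -- the Cauchy integrand as a function of the parameter q = (t, p) and the angle θ
  set K : ℂ × P → ℝ → F := fun q θ =>
    deriv (circleMap q₀.1 ρ) θ • ((circleMap q₀.1 ρ θ - q.1)⁻¹ • g (circleMap q₀.1 ρ θ, q.2))
    with hK
  have hmemU : ∀ q ∈ V, ∀ θ : ℝ, (circleMap q₀.1 ρ θ, q.2) ∈ U := fun q hq θ =>
    hKU ⟨circleMap_mem_sphere _ hρ.le _, ball_subset_closedBall hq.2⟩
  have hne : ∀ q ∈ V, ∀ θ : ℝ, circleMap q₀.1 ρ θ - q.1 ≠ 0 := by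
    intro q hq θ h
    have := SCV.norm_circleMap_sub_ge hρ.le hq.1 θ
    rw [h, norm_zero] at this
    linarith
  -- (1) Cauchy's formula: ∫ K q = 2πi • g q on V
  have hCauchy : ∀ q ∈ V, ∫ θ in Icc 0 (2 * Real.pi), K q θ = (2 * Real.pi * I : ℂ) • g q := by
    intro q hq
    have hcirc := Complex.circleIntegral_sub_inv_smul_of_differentiable_on_off_countable
      (f := fun s => g (s, q.2)) countable_empty (ball_subset_ball (by linarith) hq.1 :
        q.1 ∈ ball q₀.1 ρ) ?_ ?_
    · rw [circleIntegral_def_Icc] at hcirc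
      simpa [hK] using hcirc
    · exact (ht q.2).continuousOn.mono (hslice_sub q hq)
    · rintro x ⟨hx, -⟩
      exact (ht q.2).differentiableAt
        ((hslice_open q.2).mem_nhds (hslice_sub q hq (ball_subset_closedBall hx)))
  -- (2) the parameter integral is holomorphic on V
  have hInt : DifferentiableOn ℂ (fun q => ∫ θ in Icc 0 (2 * Real.pi), K q θ) V := by
    refine differentiableOn_integral_of_dominated (μ := volume.restrict (Icc 0 (2 * Real.pi)))
      (fun q hq => ?_) (Eventually.of_forall fun θ => ?_) (fun x hx => ?_)
    · -- measurability: the integrand is continuous in θ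
      refine Continuous.aestronglyMeasurable ?_
      have h1 : Continuous fun θ : ℝ => deriv (circleMap q₀.1 ρ) θ := by
        simp only [deriv_circleMap]; fun_prop
      have h2 : Continuous fun θ : ℝ => (circleMap q₀.1 ρ θ - q.1)⁻¹ :=
        ((continuous_circleMap _ _).sub continuous_const).inv₀ (hne q hq)
      have h3 : Continuous fun θ : ℝ => g (circleMap q₀.1 ρ θ, q.2) :=
        (ht q.2).continuousOn.comp_continuous (continuous_circleMap _ _) fun θ =>
          hslice_sub q hq (circleMap_mem_closedBall _ hρ.le θ)
      exact h1.smul (h2.smul h3)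
    · -- holomorphy in q for fixed θ
      have h1 : DifferentiableOn ℂ (fun q : ℂ × P => (circleMap q₀.1 ρ θ - q.1)⁻¹) V :=
        ((differentiableOn_const _).sub differentiableOn_fst).inv fun q hq => hne q hq θ
      have h2 : DifferentiableOn ℂ (fun q : ℂ × P => g (circleMap q₀.1 ρ θ, q.2)) V := by
        have h := hp (circleMap q₀.1 ρ θ)
        exact h.comp differentiableOn_snd fun q hq => hmemU q hq θ
      exact (h1.smul h2).const_smul _
    · -- global majorant
      obtain ⟨R, hR, hRV⟩ := Metric.isOpen_iff.1 hVo x hx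
      refine ⟨R, hR, hRV, fun _ => ρ * (ρ / 2)⁻¹ * M, integrable_const _,
        Eventually.of_forall fun θ q hq => ?_⟩
      have hqV := hRV hq
      rw [hK]
      simp only [norm_smul]
      have e1 : ‖deriv (circleMap q₀.1 ρ) θ‖ = ρ := by
        rw [deriv_circleMap, norm_mul, norm_circleMap_zero, Complex.norm_I, mul_one,
          abs_of_nonneg hρ.le]
      have e2 : ‖(circleMap q₀.1 ρ θ - q.1)⁻¹‖ ≤ (ρ / 2)⁻¹ := by
        rw [norm_inv]
        exact inv_anti₀ (by positivity) (SCV.norm_circleMap_sub_ge hρ.le hqV.1 θ)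
      have e3 : ‖g (circleMap q₀.1 ρ θ, q.2)‖ ≤ M :=
        hMg _ ⟨circleMap_mem_sphere _ hρ.le _, ball_subset_closedBall hqV.2⟩
      rw [e1]
      have : 0 ≤ (ρ / 2)⁻¹ := by positivity
      calc ρ * (‖(circleMap q₀.1 ρ θ - q.1)⁻¹‖ * ‖g (circleMap q₀.1 ρ θ, q.2)‖)
          ≤ ρ * ((ρ / 2)⁻¹ * M) :=
            mul_le_mul_of_nonneg_left (mul_le_mul e2 e3 (norm_nonneg _) this) hρ.le
        _ = ρ * (ρ / 2)⁻¹ * M := by ring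
  -- (3) conclude
  have h2pi : (2 * Real.pi * I : ℂ) ≠ 0 := by simp [Real.pi_ne_zero, Complex.I_ne_zero]
  refine ((hInt.const_smul (2 * Real.pi * I : ℂ)⁻¹).congr fun q hq => ?_)
  simp only [Pi.smul_apply]
  rw [hCauchy q hq, smul_smul, inv_mul_cancel₀ h2pi, one_smul]

end Osgood

/-! ### Slices of functions holomorphic on the diamond `{|Im z| + |Im w| < b}` -/

variable {b : ℝ}

/-- The slice `ξ ↦ G (ξ, η)` of a function holomorphic on the diamond `{|Im z| + |Im w| < b}` is
holomorphic on the strip `{|Im ξ| < b - |Im η|}`. [folklore] -/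
theorem differentiableOn_diamond_slice_fst {G : ℂ × ℂ → ℂ}
    (hG : DifferentiableOn ℂ G {p : ℂ × ℂ | |p.1.im| + |p.2.im| < b}) (η : ℂ) :
    DifferentiableOn ℂ (fun ξ : ℂ => G (ξ, η)) {ξ : ℂ | |ξ.im| < b - |η.im|} :=
  hG.comp (differentiableOn_id.prodMk (differentiableOn_const _)) fun ξ hξ => by
    simp only [mem_setOf_eq] at hξ ⊢; linarith

/-- The slice `η ↦ G (ξ, η)` of a function holomorphic on the diamond `{|Im z| + |Im w| < b}` is
holomorphic on the strip `{|Im η| < b - |Im ξ|}`. [folklore] -/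
theorem differentiableOn_diamond_slice_snd {G : ℂ × ℂ → ℂ}
    (hG : DifferentiableOn ℂ G {p : ℂ × ℂ | |p.1.im| + |p.2.im| < b}) (ξ : ℂ) :
    DifferentiableOn ℂ (fun η : ℂ => G (ξ, η)) {η : ℂ | |η.im| < b - |ξ.im|} :=
  hG.comp ((differentiableOn_const _).prodMk differentiableOn_id) fun η hη => by
    simp only [mem_setOf_eq] at hη ⊢; linarith

/-- The width of a slice at a real point is the full width: `b - |Im x| = b`. [folklore] -/
theorem sub_abs_ofReal_im (b x : ℝ) : b - |(x : ℂ).im| = b := by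
  rw [Complex.ofReal_im, abs_zero, sub_zero]

/-! ### The bounded cross theorem for three strips -/

/-- **The bounded cross theorem for three strips** (Bernstein 1912 / Siciak 1969; Jarnicki–Pflug,
*Separately Analytic Functions*, Ch. 5, `N`-fold cross with the relative extremal function
`|Im z|/b`): a function `F` of three real variables which in each variable separately (the other two
real) is the restriction of a function holomorphic and bounded by `M` on the strip `{|Im| < b}` is
the restriction of ONE function holomorphic on the tube `{|Im z₁| + |Im z₂| + |Im z₃| < b}` and
bounded by `M` there. Derived from the two-strip theorem
(`exists_holomorphic_extension_diamond_of_separately`) applied twice, the identity theorem on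
strips, and the bounded Osgood lemma.
[cite: JarnickiPflug2011, Ch. 5 (classical cross theorem with estimate)] -/
theorem exists_holomorphic_extension_of_separately_three {M : ℝ} {F : ℝ → ℝ → ℝ → ℂ} (hb : 0 < b)
    (h1 : ∀ y z : ℝ, ∃ g : ℂ → ℂ, DifferentiableOn ℂ g {w : ℂ | |w.im| < b} ∧
      (∀ w : ℂ, |w.im| < b → ‖g w‖ ≤ M) ∧ ∀ x : ℝ, g x = F x y z)
    (h2 : ∀ x z : ℝ, ∃ g : ℂ → ℂ, DifferentiableOn ℂ g {w : ℂ | |w.im| < b} ∧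
      (∀ w : ℂ, |w.im| < b → ‖g w‖ ≤ M) ∧ ∀ y : ℝ, g y = F x y z)
    (h3 : ∀ x y : ℝ, ∃ g : ℂ → ℂ, DifferentiableOn ℂ g {w : ℂ | |w.im| < b} ∧
      (∀ w : ℂ, |w.im| < b → ‖g w‖ ≤ M) ∧ ∀ z : ℝ, g z = F x y z) :
    ∃ G : ℂ × ℂ × ℂ → ℂ,
      DifferentiableOn ℂ G {p : ℂ × ℂ × ℂ | |p.1.im| + |p.2.1.im| + |p.2.2.im| < b} ∧
      (∀ p : ℂ × ℂ × ℂ, |p.1.im| + |p.2.1.im| + |p.2.2.im| < b → ‖G p‖ ≤ M) ∧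
      ∀ x y z : ℝ, G ((x : ℂ), (y : ℂ), (z : ℂ)) = F x y z := by
  -- Step 1: joint extension in `(x, y)` for every real `z`
  have hG1 : ∀ z : ℝ, ∃ G : ℂ × ℂ → ℂ,
      DifferentiableOn ℂ G {p : ℂ × ℂ | |p.1.im| + |p.2.im| < b} ∧
      (∀ p : ℂ × ℂ, |p.1.im| + |p.2.im| < b → ‖G p‖ ≤ M) ∧
      ∀ x y : ℝ, G ((x : ℂ), (y : ℂ)) = F x y z := fun z =>
    exists_holomorphic_extension_diamond_of_separately hb (fun y => h1 y z) (fun x => h2 x z)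
  choose G₁ hG₁d hG₁b hG₁r using hG1
  -- Step 2: joint extension in `(x, z)` for every real `y`
  have hG2 : ∀ y : ℝ, ∃ G : ℂ × ℂ → ℂ,
      DifferentiableOn ℂ G {p : ℂ × ℂ | |p.1.im| + |p.2.im| < b} ∧
      (∀ p : ℂ × ℂ, |p.1.im| + |p.2.im| < b → ‖G p‖ ≤ M) ∧
      ∀ x z : ℝ, G ((x : ℂ), (z : ℂ)) = F x y z := fun y =>
    exists_holomorphic_extension_diamond_of_separately hb (fun z => h1 y z) (fun x => h3 x y)
  choose G₂ hG₂d hG₂b hG₂r using hG2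
  -- Step 3: consistency `G₁ z (ξ, y) = G₂ y (ξ, z)` on the strip (identity theorem in `ξ`)
  have hcons : ∀ (y z : ℝ) (ξ : ℂ), |ξ.im| < b → G₁ z (ξ, y) = G₂ y (ξ, z) := by
    intro y z ξ hξ
    have hd1 := differentiableOn_diamond_slice_fst (hG₁d z) (y : ℂ)
    have hd2 := differentiableOn_diamond_slice_fst (hG₂d y) (z : ℂ)
    rw [sub_abs_ofReal_im] at hd1 hd2
    exact eqOn_setOf_abs_im_lt_of_forall_ofReal hb hd1 hd2 (fun t => by
      show G₁ z (t, y) = G₂ y (t, z)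
      rw [hG₁r, hG₂r]) hξ
  -- Step 4: for complex `ξ`, joint extension in `(y, z)` on the strip of width `b - |Im ξ|`
  have hG3 : ∀ ξ : ℂ, ∃ G : ℂ × ℂ → ℂ, |ξ.im| < b →
      DifferentiableOn ℂ G {p : ℂ × ℂ | |p.1.im| + |p.2.im| < b - |ξ.im|} ∧
      (∀ p : ℂ × ℂ, |p.1.im| + |p.2.im| < b - |ξ.im| → ‖G p‖ ≤ M) ∧
      ∀ y z : ℝ, G ((y : ℂ), (z : ℂ)) = G₁ z (ξ, y) := by
    intro ξ
    by_cases hξ : |ξ.im| < b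
    · have hb' : 0 < b - |ξ.im| := sub_pos.2 hξ
      obtain ⟨G, hG⟩ := exists_holomorphic_extension_diamond_of_separately hb'
        (F := fun y z => G₁ z (ξ, y))
        (fun z => ⟨fun η => G₁ z (ξ, η), differentiableOn_diamond_slice_snd (hG₁d z) ξ,
          fun η hη => hG₁b z _ (by simp only; linarith), fun y => rfl⟩)
        (fun y => ⟨fun ζ => G₂ y (ξ, ζ), differentiableOn_diamond_slice_snd (hG₂d y) ξ,
          fun ζ hζ => hG₂b y _ (by simp only; linarith), fun z => (hcons y z ξ hξ).symm⟩)
      exact ⟨G, fun _ => hG⟩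
    · exact ⟨0, fun h => absurd h hξ⟩
  choose G₃ hG₃ using hG3
  -- consistency of `G₃` with `G₂` on complex `ζ` (identity theorem in `ζ`)
  have hcons₂ : ∀ (ξ : ℂ) (hξ : |ξ.im| < b) (y : ℝ) (ζ : ℂ), |ζ.im| < b - |ξ.im| →
      G₃ ξ (y, ζ) = G₂ y (ξ, ζ) := by
    intro ξ hξ y ζ hζ
    obtain ⟨hd, -, hr⟩ := hG₃ ξ hξ
    have hd1 := differentiableOn_diamond_slice_snd hd (y : ℂ)
    rw [sub_abs_ofReal_im] at hd1
    have hd2 := differentiableOn_diamond_slice_snd (hG₂d y) ξ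
    exact eqOn_setOf_abs_im_lt_of_forall_ofReal (sub_pos.2 hξ) hd1 hd2 (fun t => by
      show G₃ ξ (y, t) = G₂ y (ξ, t)
      rw [hr, hcons y t ξ hξ]) hζ
  -- the extension
  set G : ℂ × ℂ × ℂ → ℂ := fun p => G₃ p.1 (p.2.1, p.2.2) with hGdef
  -- Step 5: for complex `ζ`, a joint extension in `(ξ, η)`; it coincides with `G`
  have hG5 : ∀ ζ : ℂ, |ζ.im| < b → ∃ G₅ : ℂ × ℂ → ℂ,
      DifferentiableOn ℂ G₅ {p : ℂ × ℂ | |p.1.im| + |p.2.im| < b - |ζ.im|} ∧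
      ∀ ξ η : ℂ, |ξ.im| + |η.im| < b - |ζ.im| → G₅ (ξ, η) = G₃ ξ (η, ζ) := by
    intro ζ hζ
    have hb₅ : 0 < b - |ζ.im| := sub_pos.2 hζ
    have hx0 : ∀ x : ℝ, |(x : ℂ).im| < b := fun x => by simpa using hb
    obtain ⟨G₅, hd₅, -, hr₅⟩ := exists_holomorphic_extension_diamond_of_separately hb₅
      (F := fun x y => G₃ x (y, ζ))
      (fun y => ⟨fun ξ => G₂ y (ξ, ζ), differentiableOn_diamond_slice_fst (hG₂d y) ζ,
        fun ξ hξ => hG₂b y _ (by simp only; linarith),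
        fun x => (hcons₂ x (hx0 x) y ζ (by rw [sub_abs_ofReal_im]; exact hζ)).symm⟩)
      (fun x => by
        obtain ⟨hd, hbd, -⟩ := hG₃ x (hx0 x)
        refine ⟨fun η => G₃ x (η, ζ), ?_, fun η hη => hbd _ ?_, fun y => rfl⟩
        · have := differentiableOn_diamond_slice_fst hd ζ
          rwa [sub_abs_ofReal_im] at this
        · simp only; rw [sub_abs_ofReal_im]; linarith)
    refine ⟨G₅, hd₅, fun ξ η hξη => ?_⟩
    have hξ : |ξ.im| < b - |ζ.im| := by linarith [abs_nonneg η.im]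
    have hξb : |ξ.im| < b := by linarith [abs_nonneg ζ.im]
    -- Step A: on real `η = y`, `G₅ (ξ, y) = G₂ y (ξ, ζ)` (identity theorem in `ξ`)
    have hA : ∀ (y : ℝ) (ξ' : ℂ), |ξ'.im| < b - |ζ.im| → G₅ (ξ', y) = G₂ y (ξ', ζ) := by
      intro y ξ' hξ'
      have hd1 := differentiableOn_diamond_slice_fst hd₅ (y : ℂ)
      rw [sub_abs_ofReal_im] at hd1
      have hd2 := differentiableOn_diamond_slice_fst (hG₂d y) ζ
      exact eqOn_setOf_abs_im_lt_of_forall_ofReal hb₅ hd1 hd2 (fun t => by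
        show G₅ (t, y) = G₂ y (t, ζ)
        rw [hr₅, hcons₂ t (hx0 t) y ζ (by rw [sub_abs_ofReal_im]; exact hζ)]) hξ'
    -- Step B: identity theorem in `η`
    obtain ⟨hd, -, -⟩ := hG₃ ξ hξb
    have hd1 : DifferentiableOn ℂ (fun η => G₅ (ξ, η)) {η : ℂ | |η.im| < b - |ζ.im| - |ξ.im|} :=
      differentiableOn_diamond_slice_snd hd₅ ξ
    have hd2 : DifferentiableOn ℂ (fun η => G₃ ξ (η, ζ)) {η : ℂ | |η.im| < b - |ζ.im| - |ξ.im|} := by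
      have := differentiableOn_diamond_slice_fst hd ζ
      rwa [sub_right_comm] at this
    exact eqOn_setOf_abs_im_lt_of_forall_ofReal (by linarith) hd1 hd2 (fun t => by
      show G₅ (ξ, t) = G₃ ξ (t, ζ)
      rw [hA t ξ hξ, hcons₂ ξ hξb t ζ (by linarith [abs_nonneg ξ.im])])
      (show |η.im| < b - |ζ.im| - |ξ.im| by linarith)
  refine ⟨G, ?_, fun p hp => ?_, fun x y z => ?_⟩
  · -- joint holomorphy: bounded Osgood, first variable `ξ`, block `(η, ζ)`
    have hU : IsOpen {p : ℂ × ℂ × ℂ | |p.1.im| + |p.2.1.im| + |p.2.2.im| < b} := by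
      refine isOpen_lt ?_ continuous_const
      fun_prop
    refine differentiableOn_prod_of_separately_of_norm_le hU (M := M) (fun q hq => ?_)
      (fun q => ?_) (fun ξ => ?_)
    · simp only [mem_setOf_eq] at hq
      have hξ : |q.1.im| < b := by linarith [abs_nonneg q.2.1.im, abs_nonneg q.2.2.im]
      exact (hG₃ q.1 hξ).2.1 _ (by linarith)
    · -- holomorphy in `ξ`: `G (ξ, η, ζ) = G₅ ζ (ξ, η)`
      by_cases hζ : |q.2.im| < b
      · obtain ⟨G₅, hd₅, hr₅⟩ := hG5 q.2 hζ
        have hd : DifferentiableOn ℂ (fun ξ => G₅ (ξ, q.1))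
            {ξ : ℂ | (ξ, q) ∈ {p : ℂ × ℂ × ℂ | |p.1.im| + |p.2.1.im| + |p.2.2.im| < b}} := by
          refine (differentiableOn_diamond_slice_fst hd₅ q.1).mono fun ξ hξ => ?_
          simp only [mem_setOf_eq] at hξ ⊢
          linarith
        refine hd.congr fun ξ hξ => ?_
        simp only [mem_setOf_eq] at hξ
        exact (hr₅ ξ q.1 (by linarith)).symm
      · have he : {ξ : ℂ | (ξ, q) ∈ {p : ℂ × ℂ × ℂ | |p.1.im| + |p.2.1.im| + |p.2.2.im| < b}} = ∅ := by
          ext ξ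
          simp only [mem_setOf_eq, mem_empty_iff_false, iff_false, not_lt]
          linarith [abs_nonneg ξ.im, abs_nonneg q.1.im, not_lt.1 hζ]
        rw [he]
        exact differentiableOn_empty
    · -- holomorphy in the block `(η, ζ)`
      by_cases hξ : |ξ.im| < b
      · have he : {q : ℂ × ℂ | (ξ, q) ∈ {p : ℂ × ℂ × ℂ | |p.1.im| + |p.2.1.im| + |p.2.2.im| < b}} =
            {q : ℂ × ℂ | |q.1.im| + |q.2.im| < b - |ξ.im|} := by
          ext q
          simp only [mem_setOf_eq]
          constructor <;> intro h <;> linarith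
        rw [he]
        exact (hG₃ ξ hξ).1
      · have he : {q : ℂ × ℂ | (ξ, q) ∈ {p : ℂ × ℂ × ℂ | |p.1.im| + |p.2.1.im| + |p.2.2.im| < b}} = ∅ := by
          ext q
          simp only [mem_setOf_eq, mem_empty_iff_false, iff_false, not_lt]
          linarith [abs_nonneg q.1.im, abs_nonneg q.2.im, not_lt.1 hξ]
        rw [he]
        exact differentiableOn_empty
  · have hξ : |p.1.im| < b := by linarith [abs_nonneg p.2.1.im, abs_nonneg p.2.2.im]
    exact (hG₃ p.1 hξ).2.1 _ (by linarith)
  · show G₃ x (y, z) = F x y z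
    rw [(hG₃ x (by simpa using hb)).2.2, hG₁r]

end Literature.Analysis.Complex

end
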